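import Summits.Ventures.PercRepro.S2DichotomyTools
import Summits.Ventures.PercRepro.S2TailCell
import Summits.Ventures.PercRepro.S2SpanningCount
import Summits.Ventures.PercRepro.S2CountsCell
import Summits.Ventures.PercRepro.S2SpreadTail
import Summits.Ventures.PercRepro.S2FlatSharp
import Summits.Ventures.PercRepro.S2BasesTriangles
import Summits.Ventures.PercRepro.S2CobasisSix
import Summits.Ventures.PercRepro.S2FifteenSixScaled
import Summits.Ventures.PercRepro.S2FifteenSix
import Summits.Ventures.PercRepro.S2SpreadTriangles
import Summits.Ventures.PercRepro.S2ColoopSharp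
import Summits.Ventures.PercRepro.S2PhiFifteenFive
import Summits.Ventures.PercRepro.S2CapFree
import Summits.Ventures.PercRepro.TriangleCapEightI
import Summits.Ventures.PercRepro.RankLevelSetFourCircuitNullityFour
import Summits.Ventures.PercRepro.S1FiveCircuitBase

/-!
# PercRepro — S2: THE CELL `(15, 6)` — THE LAST CELL OF THE `p = 15` ROW (p7, gen 12; sub-claim S2)

Coloop-free: the cases `ν = 5, 4` by the concentrated tail; the SPREAD case (no set of nullity `4` on `≤ 9` points, none of nullity `5` on
`≤ 10`) by the triangle trade-off — `s₃ ≤ 3`: the sharp count against the kit's spanning bound; `s₃ = 4`: against three triangles' Bonferroni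
on the bases; `5 ≤ s₃ ≤ 7`: the top `6`-sets are COBASES, through a triangle `≤ 452` (Lemma A: a disjoint circuit of `≤ 4` points;
`S2.ncard_cobases_through_add_le`); `8 ≤ s₃ ≤ 10`: through a triangle `≤ 361` (`S2.exists_disjoint_triangle_of_eight`: on a spread core no
point lies on four triangles, so with `≥ 8` triangles every triangle has a DISJOINT one). The coloop cases through the scaled cells
(S2FifteenSixScaled). **`ThmN.c025_core_five_fifteen_six (M) [M.Finite] (hR : ρ(E) = 15) (hn : |E| = 21) (hfree) : RLS M 15 5`**.
Every numeral from lean-drafts/p7/g12/mining/gencell15six.py (six.py). Axioms: standard.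
-/

open scoped Matroid

namespace PercRepro

namespace ThmN

open Set

variable {α : Type}

/-- **The coloop-free cell `(15, 6)`**: the cases `ν = 5, 4` by the concentrated tail; the spread case by the triangle trade-off —
`s₃ ≤ 3`: the sharp count `29875` against the kit's spanning bound (need `30071`); `s₃ = 4`: `30541` against three triangles'
Bonferroni (need `30577`); `5 ≤ s₃ ≤ 7`: the COBASIS charge `452` per triangle (Lemma A: a disjoint circuit of `≤ 4` points) —
`≤ 29997`; `8 ≤ s₃ ≤ 10`: the charge `361` per triangle (`S2.exists_disjoint_triangle_of_eight`: a DISJOINT triangle) — `≤ 30008`;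
both against `30577`. -/
theorem c025_fifteen_six_cf_full (M : Matroid α) [M.Finite]
    (hR : M.eRank = ((15 : ℕ) : ℕ∞)) (hn : M.E.ncard = 15 + 6)
    (hfree : ∀ e ∈ M.E, ∃ A ⊆ M.E \ {e}, e ∉ M.closure A ∧ e ∉ M.closure ((M.E \ {e}) \ A)) (hK : ∀ e, ¬ M.IsColoop e) :
    RLS M 15 5 := by
  classical
  have hd : M.E.encard = M.eRank + ((6 : ℕ) : ℕ∞) := by
    rw [hR, ← M.ground_finite.cast_ncard_eq, hn]
    push_cast
    ring
  obtain ⟨hs3, hs4, hs5⟩ := caps_fifteen_six_cf_tk M hd hn hfree hK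
  have full : ∀ (k : ℕ) {W : Set α}, W ⊆ M.E → W.encard = M.eRk W + k →
      Matroid.topCount M 15 5 ≤ ∑ m ∈ Finset.Icc 5 6, ∑ j ∈ Finset.Icc (m + k - 6) m,
        W.ncard.choose j * (15 + 6 - W.ncard).choose (m - j) := by
    intro k W hW hWk
    refine (S2.topCount_le_sum_spanning M hR hd 5).trans ?_
    refine Finset.sum_le_sum (fun m _ => ?_)
    have h := S2.ncard_spanning_compl_le_of_nullity M hW hd hWk (m := m)
    rw [hn] at h
    exact h
  have span : ∀ (k : ℕ) {W : Set α}, W ⊆ M.E → W.encard = M.eRk W + k →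
      {X : Set α | X ⊆ M.E ∧ M.eRk X = M.eRank}.ncard ≤ ∑ m ∈ Finset.range (6 + 1), ∑ j ∈ Finset.Icc (m + k - 6) m,
        W.ncard.choose j * (15 + 6 - W.ncard).choose (m - j) := by
    intro k W hW hWk
    have h := S2.ncard_spanning_le_of_nullity M hW hd hWk
    rw [hn] at h
    exact h
  have cell : ∀ (U S m : ℕ), Matroid.topCount M 15 5 ≤ U → {X : Set α | X ⊆ M.E ∧ M.eRk X = M.eRank}.ncard ≤ S → m ≤ 1024 →
      1024 * (U : ℚ) ≤ ((1024 - m : ℕ) : ℚ) * 2 ^ (6 - 5) * (16173 : ℚ) →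
      (1024 : ℚ) * ((83863299 / 940 : ℚ) + (S : ℚ)) ≤ (m : ℚ) * 2 ^ 21 → RLS M 15 5 := by
    intro U S m hU hS hm hpoly htail
    rw [RLS_iff]
    exact c025_core_five_cell_of_topCount_spanning_xqictq5g M 15 6 (by norm_num) hR hn hfree 10 34 153 hs3 hs4 hs5 U hU S hS
      16173 (by norm_num) (phiK 15 5) (by rw [S2.phiK_fifteen_five]; norm_num) ⟨m, hm, hpoly, tail_fifteen_six_cf_tk S m htail⟩
  have cellA : ∀ (U S m : ℕ) (A : ℚ), Matroid.topCount M 15 5 ≤ U → {X : Set α | X ⊆ M.E ∧ M.eRk X = M.eRank}.ncard ≤ S → m ≤ 1024 →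
      1024 * (U : ℚ) ≤ ((1024 - m : ℕ) : ℚ) * 2 ^ (6 - 5) * (16173 : ℚ) →
      (1024 : ℚ) * (A + (S : ℚ)) ≤ (m : ℚ) * 2 ^ 21 →
      ({X : Set α | X ⊆ M.E ∧ M.eRk X ≤ 5}.ncard : ℚ) ≤ A → RLS M 15 5 := by
    intro U S m A hU hS hm hpoly htail hA
    rw [RLS_iff]
    exact c025_core_five_cell_of_counts_xqictq5g M 15 6 (by norm_num) hR hn U hU _ hA S hS
      16173 (by norm_num) (phiK 15 5) (by rw [S2.phiK_fifteen_five]; norm_num) ⟨m, hm, hpoly, htail⟩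
  by_cases h5 : ∃ W ⊆ M.E, W.ncard ≤ 10 ∧ W.encard = M.eRk W + 5
  · obtain ⟨W, hW, hWn, hWk⟩ := h5
    have hU' : Matroid.topCount M 15 5 ≤ 5544 := by
      refine (full 5 hW hWk).trans ?_
      generalize W.ncard = w at hWn ⊢
      interval_cases w <;> decide
    have hS' : {X : Set α | X ⊆ M.E ∧ M.eRk X = M.eRank}.ncard ≤ 7866 := by
      refine (span 5 hW hWk).trans ?_
      generalize W.ncard = w at hWn ⊢
      interval_cases w <;> decide
    exact cell 5544 7866 48 hU' hS' (by norm_num) (by norm_num) (by norm_num)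
  by_cases h4 : ∃ W ⊆ M.E, W.ncard ≤ 9 ∧ W.encard = M.eRk W + 4
  · obtain ⟨W, hW, hWn, hWk⟩ := h4
    have hU' : Matroid.topCount M 15 5 ≤ 17094 := by
      refine (full 4 hW hWk).trans ?_
      generalize W.ncard = w at hWn ⊢
      interval_cases w <;> decide
    have hS' : {X : Set α | X ⊆ M.E ∧ M.eRk X = M.eRank}.ncard ≤ 21946 := by
      refine (span 4 hW hWk).trans ?_
      generalize W.ncard = w at hWn ⊢
      interval_cases w <;> decide
    exact cell 17094 21946 55 hU' hS' (by norm_num) (by norm_num) (by norm_num)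
  · -- spread: rank-`5` sets `≤ 8`, rank-`4` sets `≤ 7`; the triangle trade-off and the cobasis charge
    have hflat : ∀ X ⊆ M.E, M.eRk X ≤ 5 → X.ncard ≤ 8 := fun X hX hr => by
      have := S2.ncard_le_of_eRk_le_of_not_nullity M 4 9 (by norm_num) h4 hX (r := 5) (by norm_num) (by exact_mod_cast hr)
      omega
    have hflat' : ∀ X ⊆ M.E, M.eRk X ≤ 4 → X.ncard ≤ 7 := fun X hX hr => by
      have := S2.ncard_le_of_eRk_le_of_not_nullity M 4 9 (by norm_num) h4 hX (r := 4) (by norm_num) (by exact_mod_cast hr)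
      omega
    have hA := ncard_eRk_le_five_le_spread M 15 6 (by norm_num) hR hn hfree hflat hflat' 10 34 153 hs3 hs4 hs5
    have hEcard : M.ground_finite.toFinset.card = 15 + 6 := by
      rw [← Set.ncard_eq_toFinset_card _ M.ground_finite]; exact hn
    have hL0 : ∀ e ∈ M.E, ¬ M.IsLoop e := not_isLoop_of_free M hfree
    have hs : ∀ e ∈ M.E, ∀ f ∈ M.E, e ≠ f → M.eRk {e, f} = 2 := by
      intro e he f hf hef
      have h2 : (2 : ℕ∞) ≤ M.eRk {e, f} :=
        two_le_eRk_of_two_le_ncard_of_free M hfree (pair_subset he hf) (by rw [ncard_pair hef])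
      have h3 : M.eRk {e, f} ≤ 2 := by
        have := M.eRk_le_encard {e, f}
        rwa [encard_pair hef] at this
      exact le_antisymm h3 h2
    have hC1 : ∀ L ⊆ M.E, M.eRk L = 2 → L.ncard ≤ 3 :=
      fun L hL hr => ncard_le_three_of_eRk_two M hs hfree hL hr
    have hcirc : ∀ C, M.IsCircuit C → 3 ≤ C.encard := three_le_encard_of_circuit M hL0 hs
    have hTfin : {C : Set α | M.IsCircuit C ∧ C.ncard = 3}.Finite :=
      M.ground_finite.finite_subsets.subset (fun C hC => hC.1.subset_ground)
    -- three triangles' Bonferroni on the spanning sets, once `s₃ ≥ 3`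
    have hspan3 : 3 ≤ {C : Set α | M.IsCircuit C ∧ C.ncard = 3}.ncard → {X : Set α | X ⊆ M.E ∧ M.eRk X = M.eRank}.ncard ≤ 50492 := by
      intro h3
      obtain ⟨T₁, T₂, T₃, hT₁, hT₂, hT₃, h12, h13, h23⟩ := (Set.two_lt_ncard_iff hTfin).1 (by omega)
      have hS := S2.ncard_spanning_add_le_of_three_triangles M hR hn (by norm_num) hC1 hT₁.1 hT₁.2 hT₂.1 hT₂.2 hT₃.1 hT₃.2 h12 h13 h23
      norm_num [Finset.sum_range_succ, Nat.choose] at hS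
      omega
    by_cases ht3 : {C : Set α | M.IsCircuit C ∧ C.ncard = 3}.ncard ≤ 3
    · have hU := topCount_le_flat_sharp M 15 6 (by norm_num) (by norm_num) hR hn hfree 8 7 hflat hflat' (by norm_num) (by norm_num)
        3 34 153 ht3 hs4 hs5
      norm_num [Finset.sum_range_succ, Nat.choose] at hU
      have hU' : Matroid.topCount M 15 5 ≤ 29875 := hU.trans (by norm_num)
      have hS := Matroid.ncard_spanning_le (M := M) hd
      rw [hEcard] at hS
      have hS' : {X : Set α | X ⊆ M.E ∧ M.eRk X = M.eRank}.ncard ≤ 82160 := hS.trans (by decide)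
      exact cellA 29875 82160 72 _ hU' hS' (by norm_num) (by norm_num) (by norm_num [Nat.choose]) hA
    push Not at ht3
    have hS' := hspan3 (by omega)
    by_cases ht4 : {C : Set α | M.IsCircuit C ∧ C.ncard = 3}.ncard ≤ 4
    · have hU := topCount_le_flat_sharp M 15 6 (by norm_num) (by norm_num) hR hn hfree 8 7 hflat hflat' (by norm_num) (by norm_num)
        4 34 153 ht4 hs4 hs5
      norm_num [Finset.sum_range_succ, Nat.choose] at hU
      have hU' : Matroid.topCount M 15 5 ≤ 30541 := hU.trans (by norm_num)
      exact cellA 30541 50492 56 _ hU' hS' (by norm_num) (by norm_num) (by norm_num [Nat.choose]) hA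
    push Not at ht4
    -- `s₃ ≥ 5`: the cobasis charge
    have h9 : ∀ X ⊆ M.E, X.ncard ≤ 9 → X.encard ≤ M.eRk X + 3 := by
      intro X hX hX9
      by_contra hlt
      push Not at hlt
      have hk : M.eRk X + 4 ≤ X.encard := by
        have := Order.add_one_le_of_lt hlt
        rwa [add_assoc, show (3 : ℕ∞) + 1 = 4 by norm_num] at this
      obtain ⟨W', hW'X, hW'⟩ := S2.exists_subset_encard_eq_eRk_add M hX 4 hk
      exact h4 ⟨W', hW'X.trans hX, (Set.ncard_le_ncard hW'X (M.ground_finite.subset hX)).trans hX9, hW'⟩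
    have hs6 : {C : Set α | M.IsCircuit C ∧ C.ncard = 6}.ncard ≤ (6 + 5).choose 6 :=
      Matroid.ncard_circuits_le_choose_of_encard M hd 5
    have hI5 := S2.ncard_indep_five_add_le (M := M) hC1
    rw [hn] at hI5
    have hU1 := S2.topCount_le_ncard_compl_spanning (M := M) hR hd 5
    simp only [Nat.cast_ofNat] at hU1
    have hsplit : {B : Set α | B ⊆ M.E ∧ M.eRk B = 5 ∧ B.ncard ≤ 6 ∧ M.eRk (M.E \ B) = M.eRank}.ncard ≤
        {B : Set α | B ⊆ M.E ∧ B.ncard = 5 ∧ M.eRk B = 5}.ncard +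
        {B : Set α | B ⊆ M.E ∧ B.ncard = 6 ∧ M.eRk B = 5 ∧ M.eRk (M.E \ B) = M.eRank}.ncard := by
      refine le_trans (Set.ncard_le_ncard ?_ ((M.ground_finite.finite_subsets.subset (fun B hB => hB.1)).union
        (M.ground_finite.finite_subsets.subset (fun B hB => hB.1)))) (Set.ncard_union_le _ _)
      rintro B ⟨hBE, hB5, hB6, hBs⟩
      have hBfin : B.Finite := M.ground_finite.subset hBE
      have h5le : 5 ≤ B.ncard := by
        have := M.eRk_le_encard B
        rw [hB5, ← hBfin.cast_ncard_eq] at this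
        exact_mod_cast this
      rcases (show B.ncard = 5 ∨ B.ncard = 6 by omega) with h | h
      · exact Or.inl ⟨hBE, h, hB5⟩
      · exact Or.inr ⟨hBE, h, hB5, hBs⟩
    by_cases ht7 : {C : Set α | M.IsCircuit C ∧ C.ncard = 3}.ncard ≤ 7
    · -- `5 ≤ s₃ ≤ 7`: Lemma A, charge `452`
      have htri : ∀ T : Set α, M.IsCircuit T → T.ncard = 3 →
          {B : Set α | B ⊆ M.E ∧ B.ncard = 6 ∧ T ⊆ B ∧ M.eRk (M.E \ B) = M.eRank}.ncard ≤ 452 := by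
        intro T hT hT3
        obtain ⟨C', hC', hC'4, hdis⟩ := exists_circuit_le_four_disjoint_of_five_triangles_set M hC1 (by omega) hT hT3
        have hC'fin : C'.Finite := M.ground_finite.subset hC'.subset_ground
        have hC'3 : 3 ≤ C'.ncard := by
          have := hcirc C' hC'
          rw [← hC'fin.cast_ncard_eq] at this
          exact_mod_cast this
        have h := S2.ncard_cobases_through_add_le M hR hn hT.subset_ground hC' hdis (by omega)
        rw [hn, hT3] at h
        generalize hc : C'.ncard = c at h hC'3 hC'4
        interval_cases c <;> norm_num [Nat.choose] at h <;> omega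
      have htop := S2.ncard_top_six_le M hn hcirc 452 htri
      have hU' : Matroid.topCount M 15 5 ≤ 29997 := by
        norm_num [Nat.choose] at hI5 htop hs6
        generalize {C : Set α | M.IsCircuit C ∧ C.ncard = 3}.ncard = t at hI5 htop ht4 ht7
        interval_cases t <;> norm_num [Nat.choose] at hI5 <;> omega
      exact cellA 29997 50492 56 _ hU' hS' (by norm_num) (by norm_num) (by norm_num [Nat.choose]) hA
    · -- `8 ≤ s₃ ≤ 10`: a disjoint triangle, charge `361`
      push Not at ht7
      have htri : ∀ T : Set α, M.IsCircuit T → T.ncard = 3 →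
          {B : Set α | B ⊆ M.E ∧ B.ncard = 6 ∧ T ⊆ B ∧ M.eRk (M.E \ B) = M.eRank}.ncard ≤ 361 := by
        intro T hT hT3
        obtain ⟨T', hT', hT'3, hdis⟩ := S2.exists_disjoint_triangle_of_eight M hC1 h9 (by omega) hT hT3
        have h := S2.ncard_cobases_through_add_le M hR hn hT.subset_ground hT' hdis (by omega)
        rw [hn, hT3, hT'3] at h
        norm_num [Nat.choose] at h
        omega
      have htop := S2.ncard_top_six_le M hn hcirc 361 htri
      have hU' : Matroid.topCount M 15 5 ≤ 30008 := by
        norm_num [Nat.choose] at hI5 htop hs6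
        generalize {C : Set α | M.IsCircuit C ∧ C.ncard = 3}.ncard = t at hI5 htop ht7 hs3
        interval_cases t <;> norm_num [Nat.choose] at hI5 <;> omega
      exact cellA 30008 50492 56 _ hU' hS' (by norm_num) (by norm_num) (by norm_num [Nat.choose]) hA

/-- **THE CELL `(15, 6)`**: the coloop cases through the scaled cells `(14, 6)` / `(13, 6)` (S2FifteenSixScaled), the coloop-free case
through `c025_fifteen_six_cf_full`. -/
theorem c025_core_five_fifteen_six (M : Matroid α) [M.Finite]
    (hR : M.eRank = ((15 : ℕ) : ℕ∞)) (hn : M.E.ncard = 15 + 6)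
    (hfree : ∀ e ∈ M.E, ∃ A ⊆ M.E \ {e}, e ∉ M.closure A ∧ e ∉ M.closure ((M.E \ {e}) \ A)) : RLS M 15 5 := by
  classical
  by_cases hK : ∃ e, M.IsColoop e
  · obtain ⟨e, he⟩ := hK
    obtain ⟨hn', hR', hfree', -⟩ := delete_core_data M he (p := 14) (d := 6) (by rw [hR]) hn hfree
    rw [RLS_iff]
    by_cases hK' : ∃ f, (M ＼ {e}).IsColoop f
    · obtain ⟨f, hf⟩ := hK'
      obtain ⟨hn'', hR'', hfree'', -⟩ := delete_core_data (M ＼ {e}) hf (p := 13) (d := 6) (by rw [hR']) hn' hfree'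
      have key := c025_thirteen_six_scaled ((M ＼ {e}) ＼ {f}) hR'' hn'' hfree''
      exact weighted_of_isColoop_scaled_sharp_iter M he hf (by norm_num : 4 + 1 < 13) (by rw [hR]) (phiK 15 5) key
    · push Not at hK'
      have key := c025_fourteen_six_scaled_cf (M ＼ {e}) hR' hn' hfree' hK'
      exact weighted_of_isColoop_scaled_sharp M he (by norm_num : 4 + 1 < 14) (by rw [hR]) (phiK 15 5) key
  · push Not at hK
    exact c025_fifteen_six_cf_full M hR hn hfree hK

end ThmN

end PercRepro
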